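import Literature.Topology.FourManifolds.EntranceChartEmbedding
import Literature.Topology.FourManifolds.UnorientedDiscTheoremDiffeotopy
import Literature.Topology.FourManifolds.ChartTransport

/-!
# Matching the germ of the direction map at one core direction by a compactly supported
# sphere diffeomorphism

Topic `Literature/Topology/FourManifolds` (support of `stmt-SmoothPoincare4-15190`, structure
conjugacy; step (ε4c) of the construction of the sphere diffeomorphism).  Everything here is
**proved**.

For couple saddle data `Q` (index-`1` boxes, equal bottom and saddle values), a sphere
diffeomorphism `φ₀` matching the unit core directions (`hφ0`), a saddle `s`, an end `b` with
**positive planar Jacobian** `0 < tDet φ₀ s b`, and a small radius `r`: the two smooth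
embeddings of the plane `k = φ₀ ∘ ue_A r s b` and `i' = ue_B r (σ s) b`
(`EntranceChartEmbedding.lean`) have the same centre and their local transition map is
`shrink⁻¹ ∘ tPlanar ∘ shrink` (`comp_ue_eq_ue_eventuallyEq`), of positive Jacobian at `0`; so
Hirsch's local disc theorem (`exists_isCompactlyDiffeotopicToIdIn_apply_disc_eq_local_of_det_pos`)
gives a diffeomorphism `H` of `S²`, compactly diffeotopic to the identity inside any open
`V ⊇ range i'`, with `H (ue_B r (σ s) b y) = φ₀ (ue_A r s b y)` for `‖y‖ ≤ ρ`
(`exists_matching_diffeo`).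

## References

* M. W. Hirsch, *Differential Topology* (1976), Ch. 8 §3, Thm. 3.1. [HirschDT1976]
* J. Milnor, *Lectures on the h-cobordism theorem* (1965), proof of Thm. 3.13. [MilnorHCobordism1965]
-/

open scoped Manifold ContDiff Topology
open Set Function Filter Metric Module

noncomputable section

namespace Literature.Topology.FourManifolds

open Cobordism FourManifolds.Flow TracePolar

universe u

namespace BasinCouple.SaddleData

attribute [local instance] fact_finrank_euclideanSpace_succ

variable {W : Type u} [TopologicalSpace W] [T2Space W] [SecondCountableTopology W]
  [CompactSpace W] [ChartedSpace (EuclideanHalfSpace (2 + 1)) W] [IsManifold (𝓡∂ (2 + 1)) ∞ W]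
  {gA gB : W → ℝ} {ξA ξB : Π x : W, TangentSpace (𝓡∂ (2 + 1)) x} {C : BasinCouple gA gB ξA ξB}
  {Q : C.SaddleData}

/-- Local notation for the model plane and space. -/
local notation "E2" => EuclideanSpace ℝ (Fin 2)
local notation "E3" => EuclideanSpace ℝ (Fin 3)

variable (hkA : ∀ s, (Q.QA.DA s).k = 1) (hkB : ∀ s', (Q.QB.DA s').k = 1)
  {φ : Metric.sphere (0 : E3) 1 ≃ₘ⟮𝓡 2, 𝓡 2⟯ Metric.sphere (0 : E3) 1} {s : SaddlePt 2 gA}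
  (hφ0 : ∀ b, (φ (unitVec (Q.QA.coreDir s b)) : E3) = C.A.rad⁻¹ • Q.QB.coreDir (Q.σ s) b)
  {r : ℝ} (hr : 0 < r) (hrε : r ^ 2 < Q.QA.ε ^ 2)

include hrε in
/-- The radius condition for `B`. [folklore] -/
theorem hrεB : r ^ 2 < Q.QB.ε ^ 2 := by rw [Q.ε_eq]; exact hrε

include hkB hφ0 in
/-- **The two embeddings have the same centre.** [folklore] -/
theorem comp_ue_zero (b : Bool) : φ (Q.QA.ue r s b 0) = Q.QB.ue r (Q.σ s) b 0 := by
  rw [Q.QA.ue_zero, Q.QB.ue_zero]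
  apply Subtype.ext
  have hne : Q.QB.coreDir (Q.σ s) b ≠ 0 := by
    rw [← norm_ne_zero_iff, Q.QB.norm_coreDir (hkB _)]; exact C.B.rad_pos.ne'
  rw [hφ0, coe_unitVec hne, Q.QB.norm_coreDir (hkB _)]
  show C.A.rad⁻¹ • Q.QB.coreDir (Q.σ s) b = C.B.rad⁻¹ • Q.QB.coreDir (Q.σ s) b
  rw [C.rad_eq]

include hkA hkB hφ0 hr in
/-- **The local transition map of the two embeddings is `shrink⁻¹ ∘ tPlanar ∘ shrink` near `0`.** [cite: MilnorHCobordism1965, proof of Thm. 3.13] -/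
theorem comp_ue_eq_ue_eventuallyEq (b : Bool) :
    (φ ∘ Q.QA.ue r s b) =ᶠ[𝓝 (0 : E2)]
      (Q.QB.ue r (Q.σ s) b ∘ (BasinPair.SaddleData.shrinkB r).symm ∘ Q.tPlanar φ s b ∘ BasinPair.SaddleData.shrinkB r) := by
  -- continuity of `tPlanar ∘ shrink` at `0`, value `0`
  have hsh : ContinuousAt (BasinPair.SaddleData.shrinkB r) (0 : E2) := (BasinPair.SaddleData.contDiff_shrinkB r).continuous.continuousAt
  have hev := Q.eventually_coneU_mem_entDom hkA hkB hφ0 b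
  have hev' : ∀ᶠ y in 𝓝 (0 : E2), ‖BasinPair.SaddleData.shrinkB r y‖ ^ 2 < Q.QA.ε ^ 2 ∧
      Q.coneU φ s b (BasinPair.SaddleData.shrinkB r y) ∈ Q.QB.entDom (Q.σ s) b (Q.QB.ε ^ 2) := by
    have h := hsh.preimage_mem_nhds (by rw [BasinPair.SaddleData.shrinkB_zero]; exact hev)
    exact h
  obtain ⟨hy0, hmem0⟩ := hev.self_of_nhds
  have htc : ContinuousAt (fun y => Q.tPlanar φ s b (BasinPair.SaddleData.shrinkB r y)) (0 : E2) := by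
    refine ContinuousAt.comp (f := BasinPair.SaddleData.shrinkB r) (g := Q.tPlanar φ s b) ?_ hsh
    rw [BasinPair.SaddleData.shrinkB_zero]
    exact (Q.contMDiffAt_tPlanar hkA b hy0 hmem0).continuousAt
  have hball : ∀ᶠ y in 𝓝 (0 : E2), ‖Q.tPlanar φ s b (BasinPair.SaddleData.shrinkB r y)‖ < r := by
    have h0 : ‖Q.tPlanar φ s b (BasinPair.SaddleData.shrinkB r 0)‖ < r := by
      rw [BasinPair.SaddleData.shrinkB_zero, Q.tb_zero hkB hφ0, norm_zero]; exact hr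
    exact htc.eventually (isOpen_lt continuous_norm continuous_const |>.mem_nhds h0)
  filter_upwards [hev', hball] with y hy hty
  obtain ⟨-, hmem⟩ := hy
  show φ (Q.QA.ue r s b y) = Q.QB.ue r (Q.σ s) b ((BasinPair.SaddleData.shrinkB r).symm
    (Q.tPlanar φ s b (BasinPair.SaddleData.shrinkB r y)))
  have hnorm : ‖Q.coneU φ s b (BasinPair.SaddleData.shrinkB r y)‖ = C.B.rad := by rw [Q.norm_coneU, C.rad_eq]
  rw [BasinPair.SaddleData.ue_apply, BasinPair.SaddleData.ue_apply, BasinPair.SaddleData.shrinkB_apply_symm hr hty, tPlanar_def,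
    Q.QB.entDir_entBack (hkB _) le_rfl hmem hnorm]
  -- `unit (coneU z) = φ (unit (entDir_A z))`
  rw [coneU_def, unitVec_smul_coe C.A.rad_pos]

include hkA hkB hφ0 hr hrε in
/-- **Matching one germ.**  If the planar Jacobian of the end `b` of `s` is positive, a
diffeomorphism of `S²` compactly diffeotopic to the identity inside any open `V ⊇ range (ue_B)`
matches `φ ∘ ue_A` with `ue_B` near the centre. [cite: HirschDT1976, Ch. 8 §3, Thm. 3.1] -/
theorem exists_matching_diffeo (b : Bool) (hpos : 0 < Q.tDet φ s b) {V : Set (Metric.sphere (0 : E3) 1)}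
    (hV : range (Q.QB.ue r (Q.σ s) b) ⊆ V) :
    ∃ H : Metric.sphere (0 : E3) 1 ≃ₘ⟮𝓡 2, 𝓡 2⟯ Metric.sphere (0 : E3) 1,
      Diffeomorph.IsCompactlyDiffeotopicToIdIn V H ∧
        ∃ ρ > (0 : ℝ), ∀ y : E2, ‖y‖ ≤ ρ → H (Q.QB.ue r (Q.σ s) b y) = φ (Q.QA.ue r s b y) := by
  have hk : Manifold.IsSmoothEmbedding 𝓘(ℝ, E2) (𝓡 2) ∞ (φ ∘ Q.QA.ue r s b) := Q.QA.isSmoothEmbedding_comp_ue hr hrε (hkA s) φ b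
  have hi' : Manifold.IsSmoothEmbedding 𝓘(ℝ, E2) (𝓡 2) ∞ (Q.QB.ue r (Q.σ s) b) :=
    Q.QB.isSmoothEmbedding_ue hr (hrεB hrε) (hkB _) b
  have h0 : (φ ∘ Q.QA.ue r s b) 0 = Q.QB.ue r (Q.σ s) b 0 := Q.comp_ue_zero hkB hφ0 b
  obtain ⟨Φ, hΦt, hΦs, hΦsrc, hΦc⟩ := exists_chart_of_isSmoothEmbedding hi'
  have hΦ' : ContMDiff (𝓡 2) (𝓡 2) ∞ Φ.symm := by rw [hΦs]; exact hi'.contMDiff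
  -- the local map `Φ ∘ k = shrink⁻¹ ∘ tPlanar ∘ shrink` near `0`
  have hloc : (Φ ∘ (φ ∘ Q.QA.ue r s b)) =ᶠ[𝓝 (0 : E2)]
      ((BasinPair.SaddleData.shrinkB r).symm ∘ Q.tPlanar φ s b ∘ BasinPair.SaddleData.shrinkB r) := by
    filter_upwards [Q.comp_ue_eq_ue_eventuallyEq hkA hkB hφ0 hr b] with y hy
    simp only [comp_apply] at hy ⊢
    rw [hy, ← hΦs]
    exact Φ.right_inv (by rw [hΦt]; exact mem_univ _)
  -- its Jacobian at `0` is `tDet φ s b` up to the positive factor `det D(shrink⁻¹)(0) · det D(shrink)(0) = 1`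
  obtain ⟨hy0, hmem0⟩ := (Q.eventually_coneU_mem_entDom hkA hkB hφ0 b).self_of_nhds
  have hd1 : HasFDerivAt (BasinPair.SaddleData.shrinkB r) (fderiv ℝ (BasinPair.SaddleData.shrinkB r) 0) (0 : E2) :=
    ((BasinPair.SaddleData.contDiff_shrinkB r).differentiable (by simp) 0).hasFDerivAt
  have hd2 : HasFDerivAt (Q.tPlanar φ s b) (fderiv ℝ (Q.tPlanar φ s b) 0) (BasinPair.SaddleData.shrinkB r 0) := by
    rw [BasinPair.SaddleData.shrinkB_zero]
    exact (((Q.contMDiffAt_tPlanar hkA b hy0 hmem0).contDiffAt).differentiableAt (by simp)).hasFDerivAt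
  have hd3 : HasFDerivAt (BasinPair.SaddleData.shrinkB r).symm (fderiv ℝ (BasinPair.SaddleData.shrinkB r).symm 0)
      (Q.tPlanar φ s b (BasinPair.SaddleData.shrinkB r 0)) := by
    rw [BasinPair.SaddleData.shrinkB_zero, Q.tb_zero hkB hφ0]
    exact ((BasinPair.SaddleData.contDiffAt_shrinkB_symm (r := r) (z := 0) (by rw [norm_zero]; exact hr)).differentiableAt (by simp)).hasFDerivAt
  have hcomp := hd3.comp (0 : E2) (hd2.comp (0 : E2) hd1)
  have hderiv : fderiv ℝ (Φ ∘ (φ ∘ Q.QA.ue r s b)) 0 = (fderiv ℝ (BasinPair.SaddleData.shrinkB r).symm 0).comp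
      ((fderiv ℝ (Q.tPlanar φ s b) 0).comp (fderiv ℝ (BasinPair.SaddleData.shrinkB r) 0)) :=
    (hcomp.congr_of_eventuallyEq hloc).fderiv
  -- `det D(shrink⁻¹)(0) · det D(shrink)(0) = 1`
  have hone : LinearMap.det ((fderiv ℝ (BasinPair.SaddleData.shrinkB r).symm 0 : E2 →L[ℝ] E2) : E2 →ₗ[ℝ] E2) *
      LinearMap.det ((fderiv ℝ (BasinPair.SaddleData.shrinkB r) 0 : E2 →L[ℝ] E2) : E2 →ₗ[ℝ] E2) = 1 := by
    have hd3' : HasFDerivAt (BasinPair.SaddleData.shrinkB r).symm (fderiv ℝ (BasinPair.SaddleData.shrinkB r).symm 0)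
        (BasinPair.SaddleData.shrinkB r 0) := by
      rw [BasinPair.SaddleData.shrinkB_zero]
      exact ((BasinPair.SaddleData.contDiffAt_shrinkB_symm (r := r) (z := 0) (by rw [norm_zero]; exact hr)).differentiableAt (by simp)).hasFDerivAt
    have hc := hd3'.comp (0 : E2) hd1
    have hid : ((BasinPair.SaddleData.shrinkB r).symm ∘ BasinPair.SaddleData.shrinkB r) = id :=
      funext fun y => BasinPair.SaddleData.shrinkB_symm_apply r y
    rw [hid] at hc
    have heq := hc.unique (hasFDerivAt_id (0 : E2))
    have h := congrArg (fun T : E2 →L[ℝ] E2 => LinearMap.det (T : E2 →ₗ[ℝ] E2)) heq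
    simp only [ContinuousLinearMap.coe_id, LinearMap.det_id] at h
    rw [← h]
    show _ = LinearMap.det (((fderiv ℝ (BasinPair.SaddleData.shrinkB r).symm 0 : E2 →L[ℝ] E2) : E2 →ₗ[ℝ] E2).comp
      ((fderiv ℝ (BasinPair.SaddleData.shrinkB r) 0 : E2 →L[ℝ] E2) : E2 →ₗ[ℝ] E2))
    rw [LinearMap.det_comp]
  have hposΦ : 0 < LinearMap.det ((fderiv ℝ (Φ ∘ (φ ∘ Q.QA.ue r s b)) 0 : E2 →L[ℝ] E2) : E2 →ₗ[ℝ] E2) := by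
    rw [hderiv]
    have h : LinearMap.det ((((fderiv ℝ (BasinPair.SaddleData.shrinkB r).symm 0).comp
        ((fderiv ℝ (Q.tPlanar φ s b) 0).comp (fderiv ℝ (BasinPair.SaddleData.shrinkB r) 0)) : E2 →L[ℝ] E2) : E2 →ₗ[ℝ] E2)) =
        LinearMap.det ((fderiv ℝ (BasinPair.SaddleData.shrinkB r).symm 0 : E2 →L[ℝ] E2) : E2 →ₗ[ℝ] E2) *
          (Q.tDet φ s b * LinearMap.det ((fderiv ℝ (BasinPair.SaddleData.shrinkB r) 0 : E2 →L[ℝ] E2) : E2 →ₗ[ℝ] E2)) := by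
      show LinearMap.det ((((fderiv ℝ (BasinPair.SaddleData.shrinkB r).symm 0 : E2 →L[ℝ] E2) : E2 →ₗ[ℝ] E2).comp
        ((((fderiv ℝ (Q.tPlanar φ s b) 0 : E2 →L[ℝ] E2) : E2 →ₗ[ℝ] E2).comp
          ((fderiv ℝ (BasinPair.SaddleData.shrinkB r) 0 : E2 →L[ℝ] E2) : E2 →ₗ[ℝ] E2))))) = _
      rw [LinearMap.det_comp, LinearMap.det_comp, tDet_def]
    rw [h, mul_left_comm, hone, mul_one]
    exact hpos
  exact exists_isCompactlyDiffeotopicToIdIn_apply_disc_eq_local_of_det_pos hk h0 hΦt hΦs hΦsrc hΦc hΦ' hposΦ hV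

end BasinCouple.SaddleData

end Literature.Topology.FourManifolds
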